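import Summits.HodgeConjecture.HodgeConjecture.Theorems.F0D9opRoad2Doors
import HarnessLib

/-!
# `F0D9opRoad2` — ★ RE-HOME of `Lines/F0_D9opRoad2.lean`, PART 6 of 6 (size-lint split; cut at a declaration boundary).

Imports (bare lines; provenance here): `Theorems.F0D9opRoad2Doors` = ★ the previous part of the same `Lines` workfile (size-lint split ×6) · `HarnessLib`.
See PART 1 `Theorems/F0D9opRoad2Boundary.lean` for the full re-home header and the original module docstring (verbatim there). Namespaces and sections KEPT
(re-opened below exactly as they stand at the cut, with their `open`∕`variable` lines replayed); code bytes = the workfile՚s, docstrings included; options preamble repeated from PART 1.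
HC_CM is proved only modulo the 7 printed citations (2 remaining: hLiu418 = stmt-HodgeConjecture-24832, h413 = stmt-HodgeConjecture-24833) until rung 0 closes; a re-home is count-neutral. -/

namespace Summit.HodgeConjecture.HodgeConjecture.Cruxes.HLiu418.F0D9opRoad2
set_option linter.dupNamespace false  -- `Summit.HodgeConjecture.HodgeConjecture.…` BY DESIGN (D-0017), as in `Lines/d6_cm_curve.lean`
open CategoryTheory NumberField IsDedekindDomain MulAction
open scoped Matrix MonObj CategoryTheory.Obj
open MonoidalCategory
open Summit.HodgeConjecture.CorCM.Lines.A3Liu418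
open Literature.AlgebraicGeometry.Motives (AbelianVariety)
open Literature.AlgebraicGeometry.Motives.AbelianVariety (rationalTateModuleMap frobeniusHom zsmul_eq_zsmul_trace_comp_of_pin
  exists_finite_forall_exists_goodReductionAt_homReduction_tateSpecialisation)
open Literature.NumberTheory.GaloisRepresentations
open Literature.NumberTheory.Automorphic Literature.NumberTheory.Automorphic.UnitaryGroup
open Literature.AlgebraicGeometry.ShimuraVarieties.UnitaryCanonicalModel
open Literature.NumberTheory.Automorphic.Liu2021.AppendixC
open Literature.AlgebraicGeometry.Motives (AlgPoints IntegralModel frobeniusOver SchemeOver)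
open Literature.NumberTheory.DiophantineGeometry (geomResidueField)


/-! ### `stub_L3a` from `stub_N` + `stub_C` (kernel-checked; no `sorry` below this line) -/

/-- `X × Y → Spec R` is smooth of relative dimension `e + d` for `X`, `Y` smooth of relative dimensions `d`, `e` over any ring `R`
(base change + composition). [folklore] -/
private theorem smoothOfRelativeDimension_tensorObj_hom' {R : Type} [CommRing R] (X Y : Literature.AlgebraicGeometry.Motives.SchemeOver R)
    (d e : ℕ) [AlgebraicGeometry.SmoothOfRelativeDimension d X.hom] [AlgebraicGeometry.SmoothOfRelativeDimension e Y.hom] :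
    AlgebraicGeometry.SmoothOfRelativeDimension (e + d) (X ⊗ Y).hom := by
  haveI := AlgebraicGeometry.smoothOfRelativeDimension_isStableUnderBaseChange (n := e)
  have h1 : AlgebraicGeometry.SmoothOfRelativeDimension e (Limits.pullback.fst X.hom Y.hom) :=
    MorphismProperty.pullback_fst (P := @AlgebraicGeometry.SmoothOfRelativeDimension e) _ _ inferInstance
  have h2 : AlgebraicGeometry.SmoothOfRelativeDimension (e + d) (Limits.pullback.fst X.hom Y.hom ≫ X.hom) := inferInstance
  exact h2

/-- `X × Y → Spec R` is proper for `X`, `Y` proper over any ring `R` (base change + composition). [folklore] -/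
private theorem isProper_tensorObj_hom' {R : Type} [CommRing R] (X Y : Literature.AlgebraicGeometry.Motives.SchemeOver R)
    [AlgebraicGeometry.IsProper X.hom] [AlgebraicGeometry.IsProper Y.hom] : AlgebraicGeometry.IsProper (X ⊗ Y).hom := by
  have h1 : AlgebraicGeometry.IsProper (Limits.pullback.fst X.hom Y.hom) :=
    MorphismProperty.pullback_fst (P := @AlgebraicGeometry.IsProper) _ _ inferInstance
  have h2 : AlgebraicGeometry.IsProper (Limits.pullback.fst X.hom Y.hom ≫ X.hom) := inferInstance
  exact h2

/-- **The honest letter from the pointwise letter and generation (T3′∕T4∕T5 assembled).**  For the data of `stub_C` take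
`R := IsAbelianSchemeModel.goodReductionAt h` (reduction `𝒜_w`, `redEnd = specialFibreHom` by `rfl`; `ℓ`-adic specialisations ★
`IsAbelianSchemeModel.tateSpecialisation`).  GENERATION: `α_K` generates (★ `Albanese.generates_α`: `F` has characteristic `0`, `Algebra F ℂ` through `ι₁`,
`M⋆_K` projective and non-empty — `stub_N`) ⇒ `αd` generates (★ `Generates.of_comp` along `∇M⋆_K ↪ M⋆_K²`)
⇒ the generic fibre `μ ≫ 𝔞_F ≫ e` of `𝔞` generates (the Néron equation; ★ `Generates.of_comp` along the isomorphisms `𝒮.genericIso⁻¹ ⊗ 𝒮.genericIso⁻¹`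
and `μ`) ⇒ the special fibre `ᾱ` generates `𝒜_w` (★ `IsAbelianSchemeModel.generates_specialFibreFunctor_map`, [Serre1958MorphismesUniversels] no. 2).
TRANSPORT: `(𝒮 × 𝒮)_w` is smooth (base change of the smooth `𝒮 × 𝒮`) hence reduced and locally of finite type, so ★
`AbelianVariety.mul_frobeniusHom_eq_of_forall_geomPoints` turns the pointwise identities into `𝒯̄₁ * π = d • π² + (N w) • 𝒯̄₂` in `End 𝒜_w`
([MumfordAV1970] §4; [Lang1983AbelianVarieties] II §3; [Tate1966Endomorphisms] §1).
[cite: Lang1983AbelianVarieties, II §3 (p. 40)] [cite: Serre1958MorphismesUniversels, no. 2] [cite: MumfordAV1970, §4] [cite: BombieriGubler2006, 10.3.9 (p. 334)] -/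
theorem recordCurveEichlerShimuraHonest_of_pointwise (hNE : RecordCurveNonempty) (hC : RecordCurveEichlerShimuraPointwise) :
    RecordCurveEichlerShimuraHonest := by
  intro F _ _ _ _ ι₁ Jstar K₀ S hU7ₛ hLQ h4 isoₛ hJ hJu K
  refine (hC F ι₁ Jstar K₀ S hU7ₛ hLQ h4 isoₛ hJ hJu K).elim fun S₃ hS₃ => ⟨S₃, hS₃.1, ?_⟩
  intro w hw₃ hw hunit hhyp
  -- the abelian-scheme model `𝒜` with its group structure (bound as a local instance), then the rest of the data
  refine (hS₃.2 w hw₃ hw hunit hhyp).elim fun 𝒜 h𝒜 => h𝒜.elim fun instG hrest => ?_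
  obtain ⟨h, 𝒮, h𝒮, αd, hαd, 𝔞, h𝔞, hN⟩ := hrest
  refine ⟨h.goodReductionAt, fun ℓ _ hℓ => ⟨h.tateSpecialisation ℓ hℓ⟩, ?_⟩
  intro N hNK hn r₁ hr₁ hrN₁ r₂ hr₂ hrN₂
  obtain ⟨d, t, hd, htr, hpt⟩ := hN N hNK hn r₁ hr₁ hrN₁ r₂ hr₂ hrN₂
  refine ⟨d, t, hd, htr, ?_⟩
  -- GENERATION of the generic fibre of `𝔞`, read through the model՚s `e`
  haveI : IsMonHom h.exists_iso.choose.hom := h.exists_iso.choose_spec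
  haveI : AlgebraicGeometry.SmoothOfRelativeDimension (((CMgsm F ι₁ Jstar K₀ S h4 isoₛ)).n - 1) ((CMgsm F ι₁ Jstar K₀ S h4 isoₛ).X K).hom :=
    (CMgsm F ι₁ Jstar K₀ S h4 isoₛ).cpt.smooth_X K
  haveI : Nonempty ((CMgsm F ι₁ Jstar K₀ S h4 isoₛ).X K).left := hNE F ι₁ Jstar K₀ S h4 isoₛ K
  letI : Algebra F ℂ := ι₁.toAlgebra
  have hgen₁ : Literature.AlgebraicGeometry.Motives.Generates αd :=
    Literature.AlgebraicGeometry.Motives.Generates.of_comp ((CMgsm F ι₁ Jstar K₀ S h4 isoₛ).alb K).nabla.incl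
      (by rw [hαd]
          exact Literature.NumberTheory.Automorphic.Liu2021.AppendixC.Albanese.generates_α
            (d := (CMgsm F ι₁ Jstar K₀ S h4 isoₛ).n - 1) ((CMgsm F ι₁ Jstar K₀ S h4 isoₛ).X K)
            ((CMgsm F ι₁ Jstar K₀ S h4 isoₛ).cpt.projective_X K) ((CMgsm F ι₁ Jstar K₀ S h4 isoₛ).alb K))
  have hgen₂ : Literature.AlgebraicGeometry.Motives.Generates ((𝒮.genericIso.hom ⊗ₘ 𝒮.genericIso.hom) ≫ αd) := by
    refine Literature.AlgebraicGeometry.Motives.Generates.of_comp (𝒮.genericIso.inv ⊗ₘ 𝒮.genericIso.inv) ?_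
    rw [← Category.assoc, MonoidalCategory.tensorHom_comp_tensorHom, Iso.inv_hom_id, MonoidalCategory.id_tensorHom_id, Category.id_comp]
    exact hgen₁
  rw [← h𝔞] at hgen₂
  have hgen₃ : Literature.AlgebraicGeometry.Motives.Generates (A := (CMgsm F ι₁ Jstar K₀ S h4 isoₛ).A K)
      ((Literature.NumberTheory.EllipticCurves.genericFibre (HeightOneSpectrum.valuationSubringAtPrime F w) F).map 𝔞 ≫ h.exists_iso.choose.hom) :=
    Literature.AlgebraicGeometry.Motives.Generates.of_comp _ hgen₂
  -- generation SPREADS to the special fibre (★ T4sp), the source `𝒮 × 𝒮` being proper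
  haveI : AlgebraicGeometry.SmoothOfRelativeDimension 1 𝒮.total.hom := h𝒮.1
  haveI : AlgebraicGeometry.IsProper 𝒮.total.hom := h𝒮.2
  haveI : AlgebraicGeometry.IsProper (𝒮.total ⊗ 𝒮.total).hom := isProper_tensorObj_hom' 𝒮.total 𝒮.total
  have hgs := h.generates_specialFibreFunctor_map 𝔞 h.exists_iso.choose hgen₃
  -- the special fibre `(𝒮 × 𝒮)_w` is smooth of relative dimension `2`, hence reduced and locally of finite type
  haveI : AlgebraicGeometry.SmoothOfRelativeDimension (1 + 1) (𝒮.total ⊗ 𝒮.total).hom :=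
    smoothOfRelativeDimension_tensorObj_hom' 𝒮.total 𝒮.total 1 1
  haveI : AlgebraicGeometry.SmoothOfRelativeDimension (1 + 1)
      ((Literature.NumberTheory.DiophantineGeometry.specialFibreFunctor w).obj (𝒮.total ⊗ 𝒮.total)).hom :=
    haveI := AlgebraicGeometry.smoothOfRelativeDimension_isStableUnderBaseChange (n := 1 + 1)
    MorphismProperty.baseChange_obj _ _ ‹_›
  haveI : AlgebraicGeometry.Smooth ((Literature.NumberTheory.DiophantineGeometry.specialFibreFunctor w).obj (𝒮.total ⊗ 𝒮.total)).hom :=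
    AlgebraicGeometry.SmoothOfRelativeDimension.smooth (1 + 1) _
  haveI : AlgebraicGeometry.LocallyOfFiniteType
      ((Literature.NumberTheory.DiophantineGeometry.specialFibreFunctor w).obj (𝒮.total ⊗ 𝒮.total)).hom := inferInstance
  -- TRANSPORT to `End 𝒜_w` (the brick)
  exact AbelianVariety.mul_frobeniusHom_eq_of_forall_geomPoints (dZ := 1 + 1) hgs _ _ d (Ideal.absNorm w.asIdeal : ℤ) hpt

/-- **`stub_L3a : RecordCurveEichlerShimuraHonest` — DISCHARGED modulo `stub_N` + `stub_C`** (edition 3: the registered stub of edition 2 becomes a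
theorem; the open inputs of this sub-line are now the S-sized `stub_N` and the pole `stub_C` — F0P5a-plan box (e) ruling 22:16Z; the generic
generation input is ★ `Albanese.generates_α`).
[cite: Liu2021, Prop. D.8 (1)–(3) and Cor. D.9 proof (FJcycle.tex l. 5586–5600)] [cite: Lang1983AbelianVarieties, II §3 (p. 40)] -/
theorem stub_L3a : RecordCurveEichlerShimuraHonest :=
  recordCurveEichlerShimuraHonest_of_pointwise stub_N stub_C

/-! ### L3b: the MODEL letter from `stub_L3a` (kernel-checked; no `sorry` below this line) -/

/-- **L3b — `RecordCurveEichlerShimuraModel` (parent :87, BY NAME) from the honest letter.**  Given `ℓ` with `w ∤ ℓ` and L0-pins `(θᵢ, mᵢ)`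
of `[K twᵢ K]`: choose one small `N ⊆ K` normalised by `K` below all `γKγ⁻¹`, `γ` running through representatives `α.out` of the finitely
many cosets of both double cosets (★ `finite_orbit_level`, ★ `exists_normal_le_forall_heckeLE`, as in ★ L0 :76–83); ★ A-L3-5
`atr_comp_eq_smul_sum_albTr_of_pin` (with ★ `hI_GSM`) reads each pin geometrically, `Alb(u) ≫ θᵢ = mᵢ • Σ_α Alb(T_{rᵢ α})`; the honest
letter at `(N, rᵢ)` supplies `(d, t)` and «ES·π»; ★ `zsmul_eq_zsmul_trace_comp_of_pin` turns the pins into `d • θᵢ = mᵢ • 𝒯ᵢ` in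
`End(A_K)`; ★ `GoodReductionAt.pinned_eichlerShimura_of_honest_mul` concludes (`redEnd` ring map; `End Ā` torsion-free).
[cite: Liu2021, §4.2 (FJcycle.tex l. 2066–2074) and App. D proof of Cor. D.9 (p. 139)] [cite: Milne1986AbelianVarieties, §12 Lemma 12.2 (PDF p. 189)] -/
theorem recordCurveEichlerShimuraModel_of_honest (hL3a : RecordCurveEichlerShimuraHonest) : RecordCurveEichlerShimuraModel := by
  intro F _ _ _ _ ι₁ Jstar K₀ S hU7ₛ hLQ h4 isoₛ hJ hJu K
  refine (hL3a F ι₁ Jstar K₀ S hU7ₛ hLQ h4 isoₛ hJ hJu K).elim fun S₃ hS₃ => ⟨S₃, hS₃.1, ?_⟩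
  intro w hw₃ hw hunit hhyp
  refine (hS₃.2 w hw₃ hw hunit hhyp).elim fun R hR => ⟨R, hR.1, ?_⟩
  intro ℓ _ hwℓ θ₁ θ₂ m₁ m₂ _ _ hθ₁ hθ₂
  classical
  -- the finitely many cosets of `K tw₁ K` and `K tw₂ K`, canonical representatives, one common admissible normal level `N`
  have hfin₁ := Sec42Data.BettiPinning.finite_orbit_level (C := CMgsm F ι₁ Jstar K₀ S h4 isoₛ) K
    (UnitaryGroup.heckeElementAt ↥(maximalRealSubfield F) F (IsCMField.complexConj F) 2 Jstar
      (⟨w, rfl⟩ : UnitaryGroup.PlacesOver F (w.under (𝓞 ↥(maximalRealSubfield F))))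
      (IsCMField.complexConj_ne_one F) hJ hw (UnitaryGroup.isUnit_placeForm Jstar hJu w) (HeckeCharacter.uniformizer F w) 1)
  have hfin₂ := Sec42Data.BettiPinning.finite_orbit_level (C := CMgsm F ι₁ Jstar K₀ S h4 isoₛ) K
    (UnitaryGroup.heckeElementAt ↥(maximalRealSubfield F) F (IsCMField.complexConj F) 2 Jstar
      (⟨w, rfl⟩ : UnitaryGroup.PlacesOver F (w.under (𝓞 ↥(maximalRealSubfield F))))
      (IsCMField.complexConj_ne_one F) hJ hw (UnitaryGroup.isUnit_placeForm Jstar hJu w) (HeckeCharacter.uniformizer F w) 2)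
  haveI := hfin₁.fintype
  haveI := hfin₂.fintype
  obtain ⟨N, hNK, hN, hγ⟩ := C5.SmallLevel.exists_normal_le_forall_heckeLE
    (Finset.univ.image (fun α : orbit (K.1.1 : Subgroup (CMgsm F ι₁ Jstar K₀ S h4 isoₛ).G)
        ((UnitaryGroup.heckeElementAt ↥(maximalRealSubfield F) F (IsCMField.complexConj F) 2 Jstar
            (⟨w, rfl⟩ : UnitaryGroup.PlacesOver F (w.under (𝓞 ↥(maximalRealSubfield F))))
            (IsCMField.complexConj_ne_one F) hJ hw (UnitaryGroup.isUnit_placeForm Jstar hJu w) (HeckeCharacter.uniformizer F w) 1 :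
          (CMgsm F ι₁ Jstar K₀ S h4 isoₛ).G) : (CMgsm F ι₁ Jstar K₀ S h4 isoₛ).G ⧸ (K.1.1 : Subgroup (CMgsm F ι₁ Jstar K₀ S h4 isoₛ).G)) =>
        (α.1.out : (CMgsm F ι₁ Jstar K₀ S h4 isoₛ).G)) ∪
      Finset.univ.image (fun α : orbit (K.1.1 : Subgroup (CMgsm F ι₁ Jstar K₀ S h4 isoₛ).G)
        ((UnitaryGroup.heckeElementAt ↥(maximalRealSubfield F) F (IsCMField.complexConj F) 2 Jstar
            (⟨w, rfl⟩ : UnitaryGroup.PlacesOver F (w.under (𝓞 ↥(maximalRealSubfield F))))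
            (IsCMField.complexConj_ne_one F) hJ hw (UnitaryGroup.isUnit_placeForm Jstar hJu w) (HeckeCharacter.uniformizer F w) 2 :
          (CMgsm F ι₁ Jstar K₀ S h4 isoₛ).G) : (CMgsm F ι₁ Jstar K₀ S h4 isoₛ).G ⧸ (K.1.1 : Subgroup (CMgsm F ι₁ Jstar K₀ S h4 isoₛ).G)) =>
        (α.1.out : (CMgsm F ι₁ Jstar K₀ S h4 isoₛ).G))) K
  have hrN₁ : ∀ α : orbit (K.1.1 : Subgroup (CMgsm F ι₁ Jstar K₀ S h4 isoₛ).G)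
      ((UnitaryGroup.heckeElementAt ↥(maximalRealSubfield F) F (IsCMField.complexConj F) 2 Jstar
          (⟨w, rfl⟩ : UnitaryGroup.PlacesOver F (w.under (𝓞 ↥(maximalRealSubfield F))))
          (IsCMField.complexConj_ne_one F) hJ hw (UnitaryGroup.isUnit_placeForm Jstar hJu w) (HeckeCharacter.uniformizer F w) 1 :
        (CMgsm F ι₁ Jstar K₀ S h4 isoₛ).G) : (CMgsm F ι₁ Jstar K₀ S h4 isoₛ).G ⧸ (K.1.1 : Subgroup (CMgsm F ι₁ Jstar K₀ S h4 isoₛ).G)),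
      C5.HeckeLE (α.1.out) N K :=
    fun α => hγ _ (Finset.mem_union_left _ (Finset.mem_image_of_mem _ (Finset.mem_univ α)))
  have hrN₂ : ∀ α : orbit (K.1.1 : Subgroup (CMgsm F ι₁ Jstar K₀ S h4 isoₛ).G)
      ((UnitaryGroup.heckeElementAt ↥(maximalRealSubfield F) F (IsCMField.complexConj F) 2 Jstar
          (⟨w, rfl⟩ : UnitaryGroup.PlacesOver F (w.under (𝓞 ↥(maximalRealSubfield F))))
          (IsCMField.complexConj_ne_one F) hJ hw (UnitaryGroup.isUnit_placeForm Jstar hJu w) (HeckeCharacter.uniformizer F w) 2 :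
        (CMgsm F ι₁ Jstar K₀ S h4 isoₛ).G) : (CMgsm F ι₁ Jstar K₀ S h4 isoₛ).G ⧸ (K.1.1 : Subgroup (CMgsm F ι₁ Jstar K₀ S h4 isoₛ).G)),
      C5.HeckeLE (α.1.out) N K :=
    fun α => hγ _ (Finset.mem_union_right _ (Finset.mem_image_of_mem _ (Finset.mem_univ α)))
  -- the honest letter at `(N, α ↦ α.out)`
  obtain ⟨d, t, hd, htr, hES⟩ := hR.2 N hNK hN (fun α => α.1.out) (fun α => QuotientGroup.out_eq' α.1) hrN₁
    (fun α => α.1.out) (fun α => QuotientGroup.out_eq' α.1) hrN₂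
  rw [finsum_eq_sum_of_fintype, finsum_eq_sum_of_fintype] at hES
  -- each pin is the geometric correspondence up to `Alb(u)` and `mᵢ` (★ A-L3-5), hence `d • θᵢ = mᵢ • 𝒯ᵢ` through the trace
  have e₁ := (Literature.NumberTheory.Automorphic.Liu2021.AppendixC.sec42HeckeTranslatesGSM S hU7ₛ h4 isoₛ).atr_comp_eq_smul_sum_albTr_of_pin ℓ
    (Literature.NumberTheory.Automorphic.Liu2021.AppendixC.hI_GSM S h4 isoₛ ℓ) K N hNK _ (fun α => α.1.out)
    (fun α => QuotientGroup.out_eq' α.1) hrN₁ hθ₁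
  have e₂ := (Literature.NumberTheory.Automorphic.Liu2021.AppendixC.sec42HeckeTranslatesGSM S hU7ₛ h4 isoₛ).atr_comp_eq_smul_sum_albTr_of_pin ℓ
    (Literature.NumberTheory.Automorphic.Liu2021.AppendixC.hI_GSM S h4 isoₛ ℓ) K N hNK _ (fun α => α.1.out)
    (fun α => QuotientGroup.out_eq' α.1) hrN₂ hθ₂
  have p₁ := zsmul_eq_zsmul_trace_comp_of_pin _ t d htr e₁
  have p₂ := zsmul_eq_zsmul_trace_comp_of_pin _ t d htr e₂
  -- L3b transport (★ brick): `redEnd` is a ring map and `End Ā_K` is torsion-free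
  exact R.pinned_eichlerShimura_of_honest_mul (Ideal.absNorm w.asIdeal) hd hES p₁ p₂

/-- **`stub_L3 : RecordCurveEichlerShimuraModel` — DISCHARGED modulo `stub_L3a`** (edition 2: the registered stub of edition 1 d6dc3b5fce1e :126
becomes a theorem over the honest letter; the ONE open input of this sub-line is now `stub_L3a`).  Either `∀ R` letter still discharges the head
(`recordCurveEichlerShimuraModel_of_forall`, `D9op_of_L3forall`).
[cite: Liu2021, Prop. D.8 (1)–(3) and Cor. D.9 proof (FJcycle.tex l. 5586–5600)] [cite: Carayol1986Compositio, §10.3 p. 210] -/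
theorem stub_L3 : RecordCurveEichlerShimuraModel :=
  recordCurveEichlerShimuraModel_of_honest stub_L3a

/-! ### L5 + composition to the registered letter BY NAME (kernel-checked; no `sorry` below this line) -/

/-- Only finitely many finite places of a number field contain a non-zero natural number. [folklore] -/
private theorem finite_setOf_natCast_mem {L : Type} [Field L] [NumberField L] {p : ℕ} (hp : p ≠ 0) :
    {v : HeightOneSpectrum (𝓞 L) | (p : 𝓞 L) ∈ v.asIdeal}.Finite := by
  have hI : Ideal.span {(p : 𝓞 L)} ≠ ⊥ := by
    rw [Ne, Ideal.span_singleton_eq_bot]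
    exact_mod_cast hp
  refine (Ideal.finite_factors hI).subset fun v hv => ?_
  simp only [Set.mem_setOf_eq] at hv ⊢
  exact (Ideal.dvd_span_singleton).2 hv

/-- **`D9op_of_L3` — [Liu2021, Cor. D.9] on `M⋆` (operator form, the registered letter `CorD9OnMOp CMgsm XMgsm`) FROM the letter L3 (model form)** over the ★ layer:
L5 = the exceptional set `{w ∣ ℓ} ∪ S₃(K)`; `R`, `T` = L3՚s own datum; L0 = ★ `exists_hom_toTower_dualMap_eq_smul_heckeOperator`
×2 at `isogenyDescent_GSM` (pins of `T_{w,1}`, `T_{w,2}`); L3 = the hypothesis; L4 = ★ `Sec42Data.HeckeTranslates.towerRep_quadratic_of_redEnd`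
at `hI_GSM`, `q := Ideal.absNorm w`.  All `∃` consumed by `.elim` (no `obtain` motive over the 14-binder goal; default heartbeats); the GSM
names are FULLY QUALIFIED (`Literature.…AppendixC.*`: inside this namespace the bare names resolve to the bundled-`CMField` twins).
[cite: Liu2021, Cor. D.9 (FJcycle.tex l. 5579–5585)] [cite: Liu2021, §4.2 (FJcycle.tex l. 2152–2160)] -/
theorem D9op_of_L3 (hL3 : RecordCurveEichlerShimuraModel) : CorD9OnMOp CMgsm XMgsm := by
  intro F _ _ _ _ ι₁ ℓ _ Jstar K₀ S hU7ₛ hLQ h4 isoₛ hJ hJu K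
  -- L3's exceptional set and L5 (term-mode `.elim`: no `obtain` motive over the 14-binder goal)
  refine (hL3 F ι₁ Jstar K₀ S hU7ₛ hLQ h4 isoₛ hJ hJu K).elim fun S₃ hS₃ => ?_
  refine ⟨{w | ((ℓ : ℕ) : 𝓞 F) ∈ w.asIdeal} ∪ S₃, (finite_setOf_natCast_mem (Fact.out : ℓ.Prime).ne_zero).union hS₃.1, ?_⟩
  intro w hw₀ hw hunit hhyp 𝔓 h𝔓 σ hσ y hy
  have hwℓ : ((ℓ : ℕ) : 𝓞 F) ∉ w.asIdeal := fun h => hw₀ (Or.inl h)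
  have hw₃ : w ∉ S₃ := fun h => hw₀ (Or.inr h)
  -- L3's own good-reduction datum `R` with an `ℓ`-adic specialisation
  refine (hS₃.2 w hw₃ hw hunit hhyp).elim fun R hR => (hR.1 ℓ hwℓ).elim fun TS => ?_
  -- L0 pins at `tw 1`, `tw 2`
  refine ((Literature.NumberTheory.Automorphic.Liu2021.AppendixC.sec42HeckeTranslatesGSM S hU7ₛ h4 isoₛ).exists_hom_toTower_dualMap_eq_smul_heckeOperator ℓ
    (Literature.NumberTheory.Automorphic.Liu2021.AppendixC.isogenyDescent_GSM S hU7ₛ hLQ h4 isoₛ) K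
    (UnitaryGroup.heckeElementAt ↥(maximalRealSubfield F) F (IsCMField.complexConj F) 2 Jstar
      (⟨w, rfl⟩ : UnitaryGroup.PlacesOver F (w.under (𝓞 ↥(maximalRealSubfield F))))
      (IsCMField.complexConj_ne_one F) hJ hw (UnitaryGroup.isUnit_placeForm Jstar hJu w) (HeckeCharacter.uniformizer F w) 1)).elim
    fun m₁ h₁ => h₁.elim fun θ₁ hθ₁ => ?_
  refine ((Literature.NumberTheory.Automorphic.Liu2021.AppendixC.sec42HeckeTranslatesGSM S hU7ₛ h4 isoₛ).exists_hom_toTower_dualMap_eq_smul_heckeOperator ℓ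
    (Literature.NumberTheory.Automorphic.Liu2021.AppendixC.isogenyDescent_GSM S hU7ₛ hLQ h4 isoₛ) K
    (UnitaryGroup.heckeElementAt ↥(maximalRealSubfield F) F (IsCMField.complexConj F) 2 Jstar
      (⟨w, rfl⟩ : UnitaryGroup.PlacesOver F (w.under (𝓞 ↥(maximalRealSubfield F))))
      (IsCMField.complexConj_ne_one F) hJ hw (UnitaryGroup.isUnit_placeForm Jstar hJu w) (HeckeCharacter.uniformizer F w) 2)).elim
    fun m₂ h₂ => h₂.elim fun θ₂ hθ₂ => ?_
  -- L3 at these pins, then ★ L4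
  exact (Literature.NumberTheory.Automorphic.Liu2021.AppendixC.sec42HeckeTranslatesGSM S hU7ₛ h4 isoₛ).towerRep_quadratic_of_redEnd ℓ
    (Literature.NumberTheory.Automorphic.Liu2021.AppendixC.hI_GSM S h4 isoₛ ℓ) (Literature.NumberTheory.Automorphic.Liu2021.AppendixC.isogenyDescent_GSM S hU7ₛ hLQ h4 isoₛ) K TS _ _ (Ideal.absNorm w.asIdeal)
    hθ₁.1 hθ₂.1 hθ₁.2 hθ₂.2 (hR.2 ℓ hwℓ θ₁ θ₂ m₁ m₂ hθ₁.1 hθ₂.1 hθ₁.2 hθ₂.2) h𝔓 hσ hy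

/-- The `∀ R` letter implies the model letter off the finite set of ★ L1 (`exists_finite_forall_exists_goodReductionAt_homReduction_tateSpecialisation`
at the ONE abelian variety `A_K`, `J := Unit`, supplies an `R` with specialisations for every `ℓ ∤ w`). [cite: Shimura1998, §11.1 Prop. 14 (i) and §18.6] -/
theorem recordCurveEichlerShimuraModel_of_forall (hL3 : RecordCurveEichlerShimura) : RecordCurveEichlerShimuraModel := by
  intro F _ _ _ _ ι₁ Jstar K₀ S hU7ₛ hLQ h4 isoₛ hJ hJu K
  refine (exists_finite_forall_exists_goodReductionAt_homReduction_tateSpecialisation (J := Unit)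
    (fun _ => (CMgsm F ι₁ Jstar K₀ S h4 isoₛ).A K)).elim fun S₁ hS₁ => ?_
  refine (hL3 F ι₁ Jstar K₀ S hU7ₛ hLQ h4 isoₛ hJ hJu K).elim fun S₃ hS₃ => ⟨S₁ ∪ S₃, hS₁.1.union hS₃.1, ?_⟩
  intro w hw₀ hw hunit hhyp
  refine (hS₁.2 w (fun h => hw₀ (Or.inl h))).elim fun R hR => hR.elim fun _ hT =>
    ⟨R (), fun ℓ _ hwℓ => (hT ℓ hwℓ).elim fun TS _ => ⟨TS ()⟩, fun ℓ _ hwℓ θ₁ θ₂ m₁ m₂ hm₁ hm₂ hθ₁ hθ₂ => ?_⟩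
  exact hS₃.2 w (fun h => hw₀ (Or.inr h)) hw hunit hhyp ℓ hwℓ θ₁ θ₂ m₁ m₂ hm₁ hm₂ hθ₁ hθ₂ (R ())

/-- The registered letter from the `∀ R` form of L3 (composition of the two previous theorems). [cite: Liu2021, Cor. D.9 (FJcycle.tex l. 5579–5585)] -/
theorem D9op_of_L3forall (hL3 : RecordCurveEichlerShimura) : CorD9OnMOp CMgsm XMgsm :=
  D9op_of_L3 (recordCurveEichlerShimuraModel_of_forall hL3)

/-- **HEAD — the registered `stub_D9op` letter BY NAME**: `CorD9OnMOp CMgsm XMgsm` (2∕3′ `Lines/D6CmCurveBody.lean` :814, 3∕3′ `Lines/d6_cm_curve.lean` :93)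
from the one registered stub `stub_L3`. [cite: Liu2021, Cor. D.9 (FJcycle.tex l. 5579–5585)] -/
theorem stub_D9op_holds : CorD9OnMOp CMgsm XMgsm :=
  D9op_of_L3 stub_L3

end Summit.HodgeConjecture.HodgeConjecture.Cruxes.HLiu418.F0D9opRoad2
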